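import Summits.Parity.BatemanHorn.Theses.AlmostPrimeZeros
import Summits.Parity.BatemanHorn.Theorems.SystemLSDRealSegment.Negative.Engines
import Summits.Parity.BatemanHorn.Theorems.SystemLSDRealSegment.Negative.FinZero

/-!
# `SystemLSDRealSegment` — negative-side support: the real-segment law is blind to bounded order

Structure lemma for the crux `Summit.Parity.BatemanHorn.Theses.AlmostPrimeZeros.SystemLSDRealSegment`
(stmt-Parity-11292), from the standing disprover's work file `Cruxes/SystemLSDRealSegment/Disproof.lean` §7.1 (gen 3).

For `k ≥ 1`, `y > 1` and any `K`, the `n ≤ x` whose capped statistic `s_f(n) = Σᵢ Σ_{p^v ∥ fᵢ(n)} min(v,2)` is at most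
`K` contribute at most `x⁻¹(x+1)·y^K·e^{k(1-y) log log x} → 0` to the crux's normalised sum
(`tendsto_boundedPart_zero`). Hence the real-segment law — and the `Λ` it pins — is unchanged by ANY modification of
the statistic on `{n : s_f(n) ≤ K}`; in particular it cannot see the `n` at which every `fᵢ(n)` is prime
(`capped_stat_le_of_all_prime`: those have `s_f(n) ≤ k`), i.e. it is independent of the Bateman–Horn count itself.
The crux's content is the `y`-tilted anatomy of the almost-prime values; the route's parity content lives entirely in
`SystemZeroRepulsion` (normality), which is what transports the law to the `k`-th Taylor coefficient at `0`.
-/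

open Filter Polynomial Finset
open scoped Topology

namespace Summit.Parity.BatemanHorn.Theorems.SystemLSDRealSegment.Negative

/-- BLINDNESS TO BOUNDED ORDER: for `k ≥ 1`, `y > 1`, `K : ℕ`, the part of the crux's (real) normalised sum carried by
the `n ≤ x` with `s_f(n) ≤ K` tends to `0` (it is `≤ x⁻¹(x+1) y^K (log x)^{k(1-y)}`). [folklore] -/
theorem tendsto_boundedPart_zero {k : ℕ} (hk : 1 ≤ k) (f : Fin k → ℤ[X]) {y : ℝ} (hy : 1 < y) (K : ℕ) :
    Tendsto (fun x : ℕ => (x : ℝ)⁻¹ * Real.exp (k * (1 - y) * Real.log (Real.log x)) *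
      ∑ n ∈ (Finset.range (x + 1)).filter
          (fun n : ℕ => (∑ i, (((f i).eval (n : ℤ)).toNat.factorization.sum fun _ v => min v 2)) ≤ K),
        y ^ (∑ i, (((f i).eval (n : ℤ)).toNat.factorization.sum fun _ v => min v 2))) atTop (𝓝 0) := by
  set s : ℕ → ℕ := fun n => ∑ i, (((f i).eval (n : ℤ)).toNat.factorization.sum fun _ v => min v 2) with hs
  have hy0 : 0 ≤ y := by linarith
  have hy1 : 1 ≤ y := hy.le
  have hup : Tendsto (fun x : ℕ => (x : ℝ)⁻¹ * (x + 1) * Real.exp (k * (1 - y) * Real.log (Real.log x)) * y ^ K)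
      atTop (𝓝 0) := by
    have := ((tendsto_inv_mul_succ.mul (tendsto_normaliser_zero hk hy)).mul_const (y ^ K))
    simpa using this
  refine tendsto_of_tendsto_of_tendsto_of_le_of_le tendsto_const_nhds hup (fun x => ?_) (fun x => ?_)
  · have : 0 ≤ ∑ n ∈ (Finset.range (x + 1)).filter (fun n => s n ≤ K), y ^ s n :=
      Finset.sum_nonneg fun _ _ => pow_nonneg hy0 _
    positivity
  · have hsum : ∑ n ∈ (Finset.range (x + 1)).filter (fun n => s n ≤ K), y ^ s n ≤ (x + 1) * y ^ K := by
      calc ∑ n ∈ (Finset.range (x + 1)).filter (fun n => s n ≤ K), y ^ s n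
          ≤ ∑ n ∈ (Finset.range (x + 1)).filter (fun n => s n ≤ K), y ^ K := by
            refine Finset.sum_le_sum fun n hn => ?_
            exact pow_le_pow_right₀ hy1 (Finset.mem_filter.1 hn).2
        _ = ((Finset.range (x + 1)).filter (fun n => s n ≤ K)).card * y ^ K := by
            rw [Finset.sum_const, nsmul_eq_mul]
        _ ≤ (x + 1) * y ^ K := by
            gcongr
            have := Finset.card_filter_le (Finset.range (x + 1)) (fun n => s n ≤ K)
            rw [Finset.card_range] at this
            exact_mod_cast this
    have hpos : 0 ≤ (x : ℝ)⁻¹ * Real.exp (k * (1 - y) * Real.log (Real.log x)) := by positivity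
    calc (x : ℝ)⁻¹ * Real.exp (k * (1 - y) * Real.log (Real.log x)) *
          ∑ n ∈ (Finset.range (x + 1)).filter (fun n => s n ≤ K), y ^ s n
        ≤ (x : ℝ)⁻¹ * Real.exp (k * (1 - y) * Real.log (Real.log x)) * ((x + 1) * y ^ K) :=
          mul_le_mul_of_nonneg_left hsum hpos
      _ = (x : ℝ)⁻¹ * (x + 1) * Real.exp (k * (1 - y) * Real.log (Real.log x)) * y ^ K := by ring

/-- The `n` at which EVERY `fᵢ(n)` is prime — the Bateman–Horn count — have capped statistic `≤ k`, hence are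
invisible to the real-segment law by `tendsto_boundedPart_zero`. [folklore] -/
theorem capped_stat_le_of_all_prime {k : ℕ} (f : Fin k → ℤ[X]) {n : ℕ}
    (h : ∀ i, (((f i).eval (n : ℤ)).toNat).Prime) :
    (∑ i, (((f i).eval (n : ℤ)).toNat.factorization.sum fun _ v => min v 2)) ≤ k := by
  calc ∑ i, (((f i).eval (n : ℤ)).toNat.factorization.sum fun _ v => min v 2) ≤ ∑ _i : Fin k, 1 := by
        refine Finset.sum_le_sum fun i _ => ?_
        rw [(h i).factorization, Finsupp.sum_single_index (by simp)]
        simp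
    _ = k := by simp

/-- The BOUNDED-ORDER PART IN THE CRUX'S OWN (complex) CURRENCY: the same statement for the complex normalised sum of
`SystemLSDRealSegment` restricted to `{n : s_f(n) ≤ K}` — it tends to `0`, so adding or removing it does not change
any `Tendsto … (𝓝 L)` claim of the crux's shape. [folklore] -/
theorem tendsto_boundedPart_zero_complex {k : ℕ} (hk : 1 ≤ k) (f : Fin k → ℤ[X]) {y : ℝ} (hy : 1 < y) (K : ℕ) :
    Tendsto (fun x : ℕ => (x : ℂ)⁻¹ * Complex.exp ((k : ℂ) * (1 - (y : ℂ)) * (Real.log (Real.log x) : ℂ)) *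
      ∑ n ∈ (Finset.range (x + 1)).filter
          (fun n : ℕ => (∑ i, (((f i).eval (n : ℤ)).toNat.factorization.sum fun _ v => min v 2)) ≤ K),
        (y : ℂ) ^ (∑ i, (((f i).eval (n : ℤ)).toNat.factorization.sum fun _ v => min v 2))) atTop (𝓝 0) := by
  have h := (Complex.continuous_ofReal.tendsto 0).comp (tendsto_boundedPart_zero hk f hy K)
  rw [Complex.ofReal_zero] at h
  refine h.congr fun x => ?_
  simp only [Function.comp_apply]
  push_cast
  rfl

end Summit.Parity.BatemanHorn.Theorems.SystemLSDRealSegment.Negative
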